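import Mathlib
import HarnessLib
import Summits.AtomisticToContinuum.FouriersLaw.Theorems.VanishingNoiseTransferNoisyFourierThomsonWitnessCostsSites
import Summits.AtomisticToContinuum.FouriersLaw.Theorems.VanishingNoiseTransferNoisyFourierThomsonWitnessCostsLiouvillian
import Summits.AtomisticToContinuum.FouriersLaw.Theorems.VanishingNoiseTransferNoisyFourierThomsonWitnessSites
import Summits.AtomisticToContinuum.FouriersLaw.Theorems.VanishingNoiseTransferNoisyFourierThomsonWitnessThomsonFloorOfCosts
import Summits.AtomisticToContinuum.FouriersLaw.Theorems.VanishingNoiseTransferNoisyFourierKuboFloorOfThomsonFloor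
import Summits.AtomisticToContinuum.FouriersLaw.Theorems.VanishingNoiseTransferNoisyFourierKuboFloorOfBulkPositivity

/-!
# Bulk Abel–Green–Kubo positivity for flips alone: stub B `stub_bulkAbelGKPositivity` from the Thomson witness
(line `abel-storage-decay`, crux `VanishingNoiseTransfer.NoisyFourier`, stmt-AtomisticToContinuum-11977; lead c7 — the file
that CLOSES the registered stub B of the skeleton, `--supports stmt-AtomisticToContinuum-11977`)

Setting: the pinned anharmonic chain `𝐏 = pinnedChain ω₂ lam β γ` (parameters `> 0`), flips at every site at rate `ε > 0`,
both Langevin baths at `T > 0`, Gibbs measure `μ_T`, total current `J = Σ_i j_i`, classical Abel correctors `u` at `s > 0`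
(`L_ε u = s u − J`), the Abel–Green–Kubo pairing `σ_L(s) = ∫ J u dμ_T`, and the lead's THOMSON WITNESS

  `v = Σ_{k<L−1} (X_{k+1} − X_k)(p_k p_{k+1}/V''(r_k)) = Σ_{bonds} [p_i(p_j²φ'(r) − ∂_{q_j}H φ(r)) + p_j(p_i²φ'(r) + ∂_{q_i}H φ(r))]`

(`X_k` the single-site Liouville fields, `φ = 1/V''`), whose pattern defect is the PURE BATH TERM `P₀(Xv) = p_0² − p_{L−1}²`
(`patternAvg_liouvillian_thomsonWitness`, p161006) and whose current pairing is extensive, `∫ vJ = (L−1)T²` (p161490).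

* `thomsonWitness_costs` — the `O(L)` cost bundle of `v` with ONE constant: `v, Xv, L_{T,T}v ∈ L²(μ_T)` and
  `∫v², Σ_m ∫(v∘F_m − v)², Σ_m B_m ∫(∂_{p_m}v)², ∫(Xv)² ≤ c₂(L−1)` for all `L ≥ 2` (site costs: `…ThomsonWitnessCostsSites`,
  Liouvillian costs: `…ThomsonWitnessCostsLiouvillian`, `L_{T,T}v = Xv + γ·(two bath terms)`).
* `thomsonFloor` — A7, the `s`-UNIFORM finite-volume floor: `∃ c > 0, L₀: c(L−1) ≤ σ_L(s)` for all `L ≥ L₀`, `s ∈ (0,1]` and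
  every classical corrector (`thomsonFloor_of_costs`, p162161: the bath-refined Thomson bound p160222).
* `kuboConductanceFloor` — P, the Kubo conductance floor `D_L ≥ c' > 0` eventually in `L`, for every flip forward field
  (`kuboFloor_of_thomsonFloor`, p150333) — unconditional: the positivity half of clause (ii) of `NoisyFourier` at every `ε > 0`.
* `Cruxes.NoisyFourier.AbelStorageDecay.stub_bulkAbelGKPositivity` — the registered stub B of the line's skeleton, VERBATIM
  (`bulkPositivity_of_kuboFloor`, p150835).

This contradicts the folklore that no Green–Kubo lower bound is available for the velocity-flip chain without an exchange
noise (Bernardin–Olla 2011 §6.2): the local witness `v` does it for every pinning and every uniformly convex interaction.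
References: Bernardin–Olla 2011 §§5–6; folklore. No definitions; axioms `propext`, `Classical.choice`, `Quot.sound`.
-/

noncomputable section

open MeasureTheory Filter Topology
open scoped BigOperators
open Literature.MathematicalPhysics.KineticTheory.HeatConduction
open Summit.AtomisticToContinuum.FouriersLaw.Theorems.SuperadditiveResistance.DeviceLiouville (kin)
open Summit.AtomisticToContinuum.FouriersLaw.Theorems.NoisyFourier.ThomsonWitness.Costs
  (helper_thomsonWitnessCostsSites helper_thomsonWitnessCostsLiouvillian)
open Summit.AtomisticToContinuum.FouriersLaw.Theorems.NoisyFourier.ThomsonWitness.Algebra (generator_eq_liouvillian_add_baths)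
open Summit.AtomisticToContinuum.FouriersLaw.Theorems.NoisyFourier.ThomsonWitness.Floor (thomsonFloor_of_costs)
open Summit.AtomisticToContinuum.FouriersLaw.Theorems.NoisyFourier.KuboFloor
  (kuboFloor_of_thomsonFloor bulkPositivity_of_kuboFloor)

namespace Summit.AtomisticToContinuum.FouriersLaw.Theorems.NoisyFourier.ThomsonWitness.Floor

variable {ω₂ lam β γ : ℝ}

/-- `L_{T,T} f = X f + γ Σ_i ([i = 0] + [i = L−1])(T ∂²_{p_i} f − p_i ∂_{p_i} f)` is square integrable as soon as
`X f` and the bath terms are. [folklore] -/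
theorem memLp_generator_of_parts {L : ℕ} {T : ℝ} {μ : Measure (PhaseSpace L)} [IsFiniteMeasure μ]
    (f : PhaseSpace L → ℝ) (hX : MemLp ((pinnedChain ω₂ lam β γ).liouvillian L f) 2 μ)
    (hb : ∀ b : Fin L, MemLp (fun x => T * partialP b (partialP b f) x - x.2 b * partialP b f x) 2 μ) :
    MemLp ((pinnedChain ω₂ lam β γ).generator L T T f) 2 μ := by
  set F : Fin L → PhaseSpace L → ℝ := fun i x =>
    (if i.val = 0 then T * partialP i (partialP i f) x - x.2 i * partialP i f x else 0) +
      (if i.val = L - 1 then T * partialP i (partialP i f) x - x.2 i * partialP i f x else 0) with hF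
  have hFi : ∀ i : Fin L, MemLp (F i) 2 μ := by
    intro i
    have h1 : MemLp (fun x => if i.val = 0 then T * partialP i (partialP i f) x - x.2 i * partialP i f x else 0) 2 μ := by
      by_cases h : i.val = 0
      · simp only [if_pos h]; exact hb i
      · simp only [if_neg h]; exact memLp_const 0
    have h2 : MemLp (fun x => if i.val = L - 1 then T * partialP i (partialP i f) x - x.2 i * partialP i f x else 0)
        2 μ := by
      by_cases h : i.val = L - 1
      · simp only [if_pos h]; exact hb i
      · simp only [if_neg h]; exact memLp_const 0
    exact h1.add h2
  have hsum : MemLp (fun x => ∑ i : Fin L, F i x) 2 μ := memLp_finsetSum Finset.univ fun i _ => hFi i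
  have hγsum : MemLp (fun x => γ * ∑ i : Fin L, F i x) 2 μ := hsum.const_mul γ
  have hgen : (pinnedChain ω₂ lam β γ).generator L T T f =
      (pinnedChain ω₂ lam β γ).liouvillian L f + fun x => γ * ∑ i : Fin L, F i x := by
    funext x
    rw [Pi.add_apply, generator_eq_liouvillian_add_baths (ω₂ := ω₂) (lam := lam) (β := β) (γ := γ) T T f x]
  rw [hgen]
  exact hX.add hγsum

/-- **The `O(L)` cost bundle of the Thomson witness** (one constant `c₂` for all `L ≥ 2`): `v, Xv, L_{T,T}v ∈ L²(μ_T)`,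
`∫v², Σ_m∫(v∘F_m − v)², Σ_m B_m∫(∂_{p_m}v)², ∫(Xv)² ≤ c₂(L−1)`. [folklore] -/
theorem thomsonWitness_costs (hω : 0 < ω₂) (hl : 0 < lam) (hβ : 0 < β) (hγ : 0 < γ) {T : ℝ} (hT : 0 < T) :
    ∃ c₂ : ℝ, ∀ (L : ℕ), 2 ≤ L →
      let P := pinnedChain ω₂ lam β γ
      let v : PhaseSpace L → ℝ := fun x => ∑ i : Fin L, ∑ j : Fin L, if j.val = i.val + 1 then
        (x.2 i * (x.2 j ^ 2 * (-(6 * β * (x.1 j - x.1 i)) / (1 + 3 * β * (x.1 j - x.1 i) ^ 2) ^ 2) -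
            partialQ j (P.hamiltonian L) x * (1 / (1 + 3 * β * (x.1 j - x.1 i) ^ 2))) +
          x.2 j * (x.2 i ^ 2 * (-(6 * β * (x.1 j - x.1 i)) / (1 + 3 * β * (x.1 j - x.1 i) ^ 2) ^ 2) +
            partialQ i (P.hamiltonian L) x * (1 / (1 + 3 * β * (x.1 j - x.1 i) ^ 2))))
        else 0
      MemLp v 2 (P.gibbsMeasure L T) ∧ MemLp (P.liouvillian L v) 2 (P.gibbsMeasure L T) ∧
        MemLp (P.generator L T T v) 2 (P.gibbsMeasure L T) ∧
        ∫ x, v x ^ 2 ∂(P.gibbsMeasure L T) ≤ c₂ * ((L : ℝ) - 1) ∧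
        ∑ i : Fin L, ∫ x, (v (momentumFlip i x) - v x) ^ 2 ∂(P.gibbsMeasure L T) ≤ c₂ * ((L : ℝ) - 1) ∧
        ∑ i : Fin L, OscillatorChain.bathWeight L i * ∫ x, (partialP i v x) ^ 2 ∂(P.gibbsMeasure L T) ≤ c₂ * ((L : ℝ) - 1) ∧
        ∫ x, (P.liouvillian L v x) ^ 2 ∂(P.gibbsMeasure L T) ≤ c₂ * ((L : ℝ) - 1) := by
  obtain ⟨cS, hS⟩ := helper_thomsonWitnessCostsSites ω₂ lam β γ T hω hl hβ hγ hT
  obtain ⟨cX, hX⟩ := helper_thomsonWitnessCostsLiouvillian ω₂ lam β γ T hω hl hβ hγ hT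
  refine ⟨max cS cX, fun L hL => ?_⟩
  obtain ⟨hv2, hW, hE, hD, hbath⟩ := hS L hL
  obtain ⟨hXv2, hXX, -⟩ := hX L hL
  haveI : IsProbabilityMeasure ((pinnedChain ω₂ lam β γ).gibbsMeasure L T) :=
    pinnedChain_isProbabilityMeasure_gibbsMeasure hω hl.le hβ.le γ L hT
  have hN : (0 : ℝ) ≤ (L : ℝ) - 1 := by
    have : (2 : ℝ) ≤ L := by exact_mod_cast hL
    linarith
  have h1 : cS * ((L : ℝ) - 1) ≤ max cS cX * ((L : ℝ) - 1) := mul_le_mul_of_nonneg_right (le_max_left _ _) hN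
  have h2 : cX * ((L : ℝ) - 1) ≤ max cS cX * ((L : ℝ) - 1) := mul_le_mul_of_nonneg_right (le_max_right _ _) hN
  exact ⟨hv2, hXv2, memLp_generator_of_parts _ hXv2 hbath, hW.trans h1, hE.trans h1, hD.trans h1, hXX.trans h2⟩

/-- **A7 — the `s`-uniform Thomson floor for flips alone.** For the pinned chain (parameters `> 0`), `T > 0` and EVERY flip
rate `ε > 0` there are `c > 0` and `L₀` such that `c·(L−1) ≤ σ_L(s) = ∫ J_L u dμ_T` for all `L ≥ L₀`, `L ≥ 2`, all `s ∈ (0,1]`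
and every classical Abel corrector `u` at `s`. [folklore] -/
theorem thomsonFloor :
    ∀ (ω₂ lam β γ T ε : ℝ), 0 < ω₂ → 0 < lam → 0 < β → 0 < γ → 0 < T → 0 < ε →
      ∃ c : ℝ, 0 < c ∧ ∃ L₀ : ℕ, ∀ (L : ℕ), L₀ ≤ L → 2 ≤ L → ∀ s : ℝ, 0 < s → s ≤ 1 →
        ∀ u : PhaseSpace L → ℝ,
          (ContDiff ℝ 2 u ∧ MemLp u 2 ((pinnedChain ω₂ lam β γ).gibbsMeasure L T) ∧
            ∀ x, (pinnedChain ω₂ lam β γ).flipGenerator L T T ε u x =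
              s * u x - ∑ i : Fin L, (pinnedChain ω₂ lam β γ).bondCurrent L i x) →
          c * ((L : ℝ) - 1) ≤ ∫ x, (∑ i : Fin L, (pinnedChain ω₂ lam β γ).bondCurrent L i x) * u x
            ∂((pinnedChain ω₂ lam β γ).gibbsMeasure L T) :=
  fun _ _ _ γ _ _ hω hl hβ hγ hT hε => thomsonFloor_of_costs (γ := γ) hω hl hβ hγ hT hε (thomsonWitness_costs hω hl hβ hγ hT)

/-- **P — the Kubo conductance floor for flips alone, unconditionally.** For all parameters, `T > 0` and every `ε > 0` there
are `c > 0` and `L₀` with `c ≤ (L−1)·γ(1 − (γ/T²)∫ g (p_0² − T) dμ_T) = D_L(ε)` for every `L ≥ L₀`, `L ≥ 2` and every classical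
flip forward field `g` (`L_ε g = −(p_0²/2·2/2 − T)`…, i.e. `L_ε g = −(kin_0 − T)`): the positivity half of clause (ii) of the
crux at fixed `ε`. A7 and the landed `kuboFloor_of_thomsonFloor` (p150333). [folklore] -/
theorem kuboConductanceFloor :
    ∀ (ω₂ lam β γ T ε : ℝ), 0 < ω₂ → 0 < lam → 0 < β → 0 < γ → 0 < T → 0 < ε →
      ∃ c : ℝ, 0 < c ∧ ∃ L₀ : ℕ, ∀ (L : ℕ), L₀ ≤ L → 2 ≤ L → ∀ g : PhaseSpace L → ℝ,
        (ContDiff ℝ 2 g ∧ MemLp g 2 ((pinnedChain ω₂ lam β γ).gibbsMeasure L T) ∧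
          ∀ x, (pinnedChain ω₂ lam β γ).flipGenerator L T T ε g x = -(kin L 0 x - T)) →
        c ≤ ((L : ℝ) - 1) * (γ * (1 - γ / T ^ 2 *
          ∫ x, g x * (kin L 0 x - T) ∂((pinnedChain ω₂ lam β γ).gibbsMeasure L T))) :=
  kuboFloor_of_thomsonFloor thomsonFloor

end Summit.AtomisticToContinuum.FouriersLaw.Theorems.NoisyFourier.ThomsonWitness.Floor

namespace Summit.AtomisticToContinuum.FouriersLaw.Cruxes.NoisyFourier.AbelStorageDecay

open Summit.AtomisticToContinuum.FouriersLaw.Theorems.NoisyFourier.ThomsonWitness.Floor (kuboConductanceFloor)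
open Summit.AtomisticToContinuum.FouriersLaw.Theorems.NoisyFourier.KuboFloor (bulkPositivity_of_kuboFloor)

/-- **STUB B `stub_bulkAbelGKPositivity` of the line `abel-storage-decay` — CLOSED.** Bulk Abel–Green–Kubo positivity of the
velocity-flip pinned chain at every flip rate `ε > 0`: there are `κ₀ > 0` and `s₁ ∈ (0,1]` such that for every `s ∈ (0,s₁]`
and every family of classical Abel correctors, any limit `K` of the per-bond pairings `∫ J_L u_L dμ_T/(L−1)` has `κ₀T² ≤ K`.
From the unconditional Kubo conductance floor (`kuboConductanceFloor`, the Thomson witness) by the landed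
`bulkPositivity_of_kuboFloor` (p150835). [cite: BernardinOlla2011, §6.2] -/
theorem stub_bulkAbelGKPositivity :
    ∀ (ω₂ lam β γ T ε : ℝ), 0 < ω₂ → 0 < lam → 0 < β → 0 < γ → 0 < T → 0 < ε → ∃ κ₀ : ℝ, 0 < κ₀ ∧ ∃ s₁ : ℝ, 0 < s₁ ∧
      s₁ ≤ 1 ∧ ∀ s : ℝ, 0 < s → s ≤ s₁ → ∀ u : (L : ℕ) →
      Literature.MathematicalPhysics.KineticTheory.HeatConduction.PhaseSpace L → ℝ, (∀ L : ℕ, 2 ≤ L → ContDiff ℝ 2 (u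
      L) ∧ MeasureTheory.MemLp (u L) 2 ((Literature.MathematicalPhysics.KineticTheory.HeatConduction.pinnedChain ω₂
      lam β γ).gibbsMeasure L T) ∧ ∀ x, (Literature.MathematicalPhysics.KineticTheory.HeatConduction.pinnedChain ω₂
      lam β γ).flipGenerator L T T ε (u L) x = s * u L x - ∑ i : Fin L,
      (Literature.MathematicalPhysics.KineticTheory.HeatConduction.pinnedChain ω₂ lam β γ).bondCurrent L i x) → ∀ K :
      ℝ, Filter.Tendsto (fun L : ℕ => (MeasureTheory.integral
      ((Literature.MathematicalPhysics.KineticTheory.HeatConduction.pinnedChain ω₂ lam β γ).gibbsMeasure L T) (fun x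
      => (∑ i : Fin L, (Literature.MathematicalPhysics.KineticTheory.HeatConduction.pinnedChain ω₂ lam β
      γ).bondCurrent L i x) * u L x)) / ((L : ℝ) - 1)) Filter.atTop (nhds K) → κ₀ * T ^ 2 ≤ K :=
  bulkPositivity_of_kuboFloor kuboConductanceFloor

end Summit.AtomisticToContinuum.FouriersLaw.Cruxes.NoisyFourier.AbelStorageDecay

end
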